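import Mathlib
import Summits.NavierStokesRegularity.NavierStokesRegularity.Theorems.PerpetualPumpCircuitPumpTruncationLimit
import Summits.NavierStokesRegularity.NavierStokesRegularity.Theorems.WakeRatchetTailRatchetLatticePeriod
import HarnessLib

/-!
# `WakeRatchet.TailRatchet` (stmt-NavierStokesRegularity-21808): truncation limit for one-period
# witnesses of the dyadic lattice — `DyadicScalarFronts` reduced to FINITE-DIMENSIONAL relative
# periodic points

Support file for the crux `TailRatchet` (route `WakeRatchet`; MODEL lattice ODEs of Tao 2016 §4 —
nothing here is a statement about the Navier–Stokes equations).  Companion of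
`Theorems/WakeRatchetTailRatchetLatticePeriod.lean`, which unrolled a ONE-PERIOD witness of the inviscid
dyadic lattice `Ż_n = Λ^{n-1} Z_{n-1}² − Λ^n Z_n Z_{n+1}` (a solution on a finite time interval whose end
state is `(s/Λ)` times the shift of its start state, inside a wake and a leading-edge envelope) into the
construction item `DyadicScalarFronts` that refutes the crux.  Here the witness of the FULL lattice
(`n ∈ ℤ`, infinitely many shells) is obtained from relative periodic points of its FINITE truncations,
exactly as stub D (`stub_truncationLimit`) of the proved crux `PerpetualPump.CircuitPump` did for Tao's
circuit:

* `latticePeriod_of_truncations` — fix `Λ`, a flight-time window `0 < Tmin ≤ Tmax`, a box `b : ℤ → ℝ`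
  and a floor `lo`; if at arbitrarily high level `K` the `K`-truncated lattice (shells `|n| > K` frozen at
  `0`) has a solution on `[0, Tmax]` in the box with a flight time `T ∈ [Tmin, Tmax]`, the interior
  matching `Z_n(T) = ((1+T)/Λ) Z_{n-1}(0)` (`|n| < K`) and `lo ≤ Z_0(0)`, then the full lattice has such a
  witness with the matching at EVERY shell (uniform box ⇒ equi-Lipschitz coordinates ⇒ Arzelà–Ascoli /
  Tychonoff extraction `PerpetualPumpCircuitPump.equiLipschitz_subseq` ⇒ the integral form of the equations passes to the limit
  by dominated convergence, three coordinates entering each equation; box, matching and floor are closed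
  conditions);
* `latticePeriod_translate` — time translation to the fundamental interval `[-(1+T), -1]` and the
  envelopes at the realised flight time from envelopes stated at the worst one `Tmax`;
* `dyadicScalarFronts_of_truncatedPeriods`, `not_tailRatchet_of_truncatedPeriods` — the composition
  with `dyadicScalarFronts_of_latticePeriods`: relative periodic points of the truncated dyadic lattices
  in envelope-dominated boxes, at arbitrarily small scale ratios, give `DyadicScalarFronts` and refute
  `TailRatchet`.

WHAT REMAINS for closing stmt-21808 as refuted is thus a family of FINITE-DIMENSIONAL fixed-point
problems with UNIFORM bounds: for each small `ε₀`, a box of truncated lattice states mapped into itself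
by (truncated dyadic flow for a floating time `T ∈ [Tmin,Tmax]`) ∘ (`(1+T)/Λ` · shift), with a section
keeping `Z_0(0) ≥ lo > 0` — Brouwer plus a clock/covering argument, the analogue of stubs A, C1, C2 of
`Cruxes/CircuitPump/Lines/singular-clock-gspt.lean`.  Positivity of the dyadic chain and its one-way
(upward) energy flux are the natural ingredients of the box; none of this is in print (Dombre–Gilson
1998, Mailybaev 2012–2013, Campolina–Simonnet–Thalabard 2025 treat the self-similar profile numerically /
perturbatively).

HONEST FRAMING: compactness bookkeeping about a MODEL lattice ODE; no registered stub of the skeleton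
`Cruxes/TailRatchet/Lines/birth.lean` is closed (they are refuted by name modulo the construction), no
summit statement is touched.
-/

noncomputable section

set_option linter.dupNamespace false

namespace Summit.NavierStokesRegularity.NavierStokesRegularity.Theorems

namespace WakeRatchetLatticePeriod

open Set Metric Filter Topology MeasureTheory
open scoped NNReal BoundedContinuousFunction Interval
open Literature.Analysis.FluidPDE Literature.Analysis.FluidPDE.TaoCascade
open WakeRatchetDyadicFront
open PerpetualPumpCircuitPump (equiLipschitz_subseq)

/-- The dyadic right-hand side `Λ^{n-1} v_{n-1}² − Λ^n v_n v_{n+1}` is bounded on the box `|v_k| ≤ b_k`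
by `|Λ^{n-1}| b_{n-1}² + |Λ^n| b_n b_{n+1}`. [elementary] -/
theorem dyadRHS_bound (L : ℝ) (b : ℤ → ℝ) (n : ℤ) (v : ℤ → ℝ) (hv : ∀ k, |v k| ≤ b k) :
    |L ^ (n - 1) * v (n - 1) ^ 2 - L ^ n * v n * v (n + 1)|
      ≤ |L ^ (n - 1)| * b (n - 1) ^ 2 + |L ^ n| * (b n * b (n + 1)) := by
  have hb : ∀ k, 0 ≤ b k := fun k => (abs_nonneg _).trans (hv k)
  have h1 : |L ^ (n - 1) * v (n - 1) ^ 2| ≤ |L ^ (n - 1)| * b (n - 1) ^ 2 := by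
    rw [abs_mul, abs_pow]
    exact mul_le_mul_of_nonneg_left (pow_le_pow_left₀ (abs_nonneg _) (hv _) 2) (abs_nonneg _)
  have h2 : |L ^ n * v n * v (n + 1)| ≤ |L ^ n| * (b n * b (n + 1)) := by
    rw [abs_mul, abs_mul, mul_assoc]
    exact mul_le_mul_of_nonneg_left (mul_le_mul (hv _) (hv _) (abs_nonneg _) (hb _)) (abs_nonneg _)
  exact (abs_sub _ _).trans (add_le_add h1 h2)

/-- **Truncation limit (dyadic analogue of `PerpetualPumpCircuitPump.stub_truncationLimit`).**
Fix `Λ`, a flight-time window `0 < Tmin ≤ Tmax`, a box `b : ℤ → ℝ` and a floor `lo`.  Suppose that at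
arbitrarily high truncation level `K` there are a flight time `T ∈ [Tmin, Tmax]` and a family
`Z : ℤ → ℝ → ℝ` on `[0, Tmax]` such that the shells `|n| ≤ K` solve the inviscid dyadic lattice
`Ż_n = Λ^{n-1} Z_{n-1}² − Λ^n Z_n Z_{n+1}` (one-sided derivatives at the ends), the shells `|n| > K` are
frozen at `0`, every shell stays in the box (`|Z_n(t)| ≤ b_n`), the interior shells `|n| < K` satisfy the
RELATIVE PERIODICITY `Z_n(T) = ((1+T)/Λ) · Z_{n-1}(0)` and the section condition `lo ≤ Z_0(0)` holds.
Then the FULL lattice has a one-period witness on `[0, Tmax]`: a solution in the same box, with a flight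
time `T ∈ [Tmin, Tmax]`, the relative periodicity at EVERY shell and `lo ≤ Z_0(0)` (uniform bounds ⇒
equi-Lipschitz ⇒ `equiLipschitz_subseq` ⇒ the integral form of the equations, the box, the matching and
the floor pass to the limit). [folklore; cite: Tao2016AveragedNS, §1.2 (dyadic model), §4 (4.8)] -/
theorem latticePeriod_of_truncations {L : ℝ} (b : ℤ → ℝ) {Tmin Tmax lo : ℝ}
    (hTmin : 0 < Tmin) (hTT : Tmin ≤ Tmax)
    (H : ∀ K₀ : ℕ, ∃ K : ℕ, K₀ ≤ K ∧ ∃ (T : ℝ) (Z : ℤ → ℝ → ℝ), T ∈ Icc Tmin Tmax ∧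
      (∀ n : ℤ, |n| ≤ (K : ℤ) → ∀ t ∈ Icc (0 : ℝ) Tmax, HasDerivWithinAt (Z n)
        (L ^ (n - 1) * Z (n - 1) t ^ 2 - L ^ n * Z n t * Z (n + 1) t) (Icc (0 : ℝ) Tmax) t) ∧
      (∀ n : ℤ, (K : ℤ) < |n| → ∀ t ∈ Icc (0 : ℝ) Tmax, Z n t = 0) ∧
      (∀ n : ℤ, ∀ t ∈ Icc (0 : ℝ) Tmax, |Z n t| ≤ b n) ∧
      (∀ n : ℤ, |n| < (K : ℤ) → Z n T = (1 + T) / L * Z (n - 1) 0) ∧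
      lo ≤ Z 0 0) :
    ∃ (T : ℝ) (Z : ℤ → ℝ → ℝ), T ∈ Icc Tmin Tmax ∧
      (∀ n : ℤ, ∀ t ∈ Icc (0 : ℝ) Tmax, HasDerivWithinAt (Z n)
        (L ^ (n - 1) * Z (n - 1) t ^ 2 - L ^ n * Z n t * Z (n + 1) t) (Icc (0 : ℝ) Tmax) t) ∧
      (∀ n : ℤ, ∀ t ∈ Icc (0 : ℝ) Tmax, |Z n t| ≤ b n) ∧
      (∀ n : ℤ, Z n T = (1 + T) / L * Z (n - 1) 0) ∧
      lo ≤ Z 0 0 := by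
  -- data at levels `K k ≥ k`
  choose K hKk T Z hT hD hzero hbox hmatch hlo using H
  have h0T : (0 : ℝ) ≤ Tmax := hTmin.le.trans hTT
  have h0I : (0 : ℝ) ∈ Icc 0 Tmax := ⟨le_rfl, h0T⟩
  have hTI : ∀ k, T k ∈ Icc 0 Tmax := fun k => ⟨hTmin.le.trans (hT k).1, (hT k).2⟩
  have hb0 : ∀ n, 0 ≤ b n := fun n => (abs_nonneg _).trans (hbox 0 n 0 h0I)
  -- uniform derivative bounds and equi-Lipschitz estimates
  set M : ℤ → ℝ≥0 := fun n =>
    ⟨|L ^ (n - 1)| * b (n - 1) ^ 2 + |L ^ n| * (b n * b (n + 1)), by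
      have := hb0 n; have := hb0 (n + 1); positivity⟩ with hM
  have hMval : ∀ n, ((M n : ℝ≥0) : ℝ) = |L ^ (n - 1)| * b (n - 1) ^ 2 + |L ^ n| * (b n * b (n + 1)) :=
    fun n => rfl
  have hLip : ∀ k (n : ℤ), LipschitzOnWith (M n) (Z k n) (Icc 0 Tmax) := by
    intro k n
    rcases le_or_gt |n| (K k : ℤ) with hle | hlt
    · refine (convex_Icc 0 Tmax).lipschitzOnWith_of_nnnorm_hasDerivWithin_le
        (fun t ht => hD k n hle t ht) fun t ht => ?_
      rw [← NNReal.coe_le_coe, coe_nnnorm, Real.norm_eq_abs, hMval]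
      exact dyadRHS_bound L b n (fun n' => Z k n' t) fun n' => hbox k n' t ht
    · intro s hs t ht
      simp [hzero k n hlt s hs, hzero k n hlt t ht]
  have hcZ : ∀ k n, ContinuousOn (Z k n) (Icc 0 Tmax) := fun k n => (hLip k n).continuousOn
  -- extraction of a subsequence converging in every coordinate, with the flight times
  obtain ⟨g, T', φ, hT', hφ, hTφ, hgc, hgb, hlim⟩ := equiLipschitz_subseq (ι := ℤ)
    h0T b M (fun k n => Z k n) T hT (fun k n t ht => hbox k n t ht) hLip
  have hpt : ∀ n, ∀ t ∈ Icc (0 : ℝ) Tmax,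
      Tendsto (fun k => Z (φ k) n t) atTop (𝓝 (g n t)) :=
    fun n t ht => hlim n (fun _ => t) t (fun _ => ht) tendsto_const_nhds
  -- along the subsequence the level eventually exceeds any `|n|`
  have hev : ∀ n : ℤ, ∀ᶠ k in atTop, |n| < (K (φ k) : ℤ) := fun n =>
    eventually_atTop.2 ⟨n.natAbs + 1, fun k hk => by
      rw [Int.abs_eq_natAbs]
      have : n.natAbs + 1 ≤ K (φ k) := hk.trans ((hφ.id_le k).trans (hKk (φ k)))
      exact_mod_cast this⟩
  refine ⟨T', g, hT', fun n t ht => ?_, fun n t ht => hgb n t ht, fun n => ?_, ?_⟩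
  · -- the equations, through their integral form
    have hFk : ∀ k, ContinuousOn
        (fun s => L ^ (n - 1) * Z k (n - 1) s ^ 2 - L ^ n * Z k n s * Z k (n + 1) s) (Icc 0 Tmax) :=
      fun k => (((hcZ k (n - 1)).pow 2).const_smul (L ^ (n - 1))).sub
        (((hcZ k n).const_smul (L ^ n)).mul (hcZ k (n + 1)))
    have hFl : Continuous fun s => L ^ (n - 1) * g (n - 1) s ^ 2 - L ^ n * g n s * g (n + 1) s := by
      have := hgc (n - 1); have := hgc n; have := hgc (n + 1)
      fun_prop
    have hint : ∀ k, |n| ≤ (K (φ k) : ℤ) → ∀ u ∈ Icc (0 : ℝ) Tmax, Z (φ k) n u =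
        Z (φ k) n 0 + ∫ s in (0 : ℝ)..u,
          (L ^ (n - 1) * Z (φ k) (n - 1) s ^ 2 - L ^ n * Z (φ k) n s * Z (φ k) (n + 1) s) := by
      intro k hk u hu
      have := intervalIntegral.integral_eq_sub_of_hasDeriv_right_of_le hu.1
        ((hcZ (φ k) n).mono (Icc_subset_Icc_right hu.2))
        (fun s hs => ((hD (φ k) n hk s ⟨hs.1.le, hs.2.le.trans hu.2⟩).hasDerivAt
          (Icc_mem_nhds hs.1 (hs.2.trans_le hu.2))).hasDerivWithinAt)
        (((hFk (φ k)).mono (Icc_subset_Icc_right hu.2)).intervalIntegrable_of_Icc hu.1)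
      linarith
    have hintl : ∀ u ∈ Icc (0 : ℝ) Tmax, g n u =
        g n 0 + ∫ s in (0 : ℝ)..u, (L ^ (n - 1) * g (n - 1) s ^ 2 - L ^ n * g n s * g (n + 1) s) := by
      intro u hu
      have hsub : Ι (0 : ℝ) u ⊆ Icc 0 Tmax := by
        rw [uIoc_of_le hu.1]
        exact fun s hs => ⟨hs.1.le, hs.2.trans hu.2⟩
      refine tendsto_nhds_unique_of_eventuallyEq (hpt n u hu) ((hpt n 0 h0I).add ?_)
        ((hev n).mono fun k hk => hint k hk.le u hu)
      refine intervalIntegral.tendsto_integral_filter_of_dominated_convergence (fun _ => (M n : ℝ))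
        (Eventually.of_forall fun k =>
          ((hFk (φ k)).mono hsub).aestronglyMeasurable measurableSet_uIoc)
        (Eventually.of_forall fun k => ae_of_all _ fun s hs => ?_) intervalIntegrable_const
        (ae_of_all _ fun s hs => ?_)
      · rw [Real.norm_eq_abs, hMval]
        exact dyadRHS_bound L b n (fun n' => Z (φ k) n' s) fun n' => hbox (φ k) n' s (hsub hs)
      · exact ((((hpt (n - 1) s (hsub hs)).pow 2).const_mul (L ^ (n - 1))).sub
          ((((hpt n s (hsub hs)).const_mul (L ^ n)).mul (hpt (n + 1) s (hsub hs)))))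
    haveI : Fact (t ∈ Icc (0 : ℝ) Tmax) := ⟨ht⟩
    have hder := intervalIntegral.integral_hasDerivWithinAt_right (a := 0) (b := t)
      (s := Icc (0 : ℝ) Tmax) (t := Icc (0 : ℝ) Tmax) (hFl.intervalIntegrable _ _)
      (hFl.stronglyMeasurableAtFilter _ _) hFl.continuousWithinAt
    exact (hder.const_add (g n 0)).congr_of_mem (fun u hu => hintl u hu) ht
  · -- the matching identity
    have hc : Tendsto (fun k => (1 + T (φ k)) / L * Z (φ k) (n - 1) 0) atTop
        (𝓝 ((1 + T') / L * g (n - 1) 0)) :=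
      ((tendsto_const_nhds.add hTφ).div_const L).mul (hpt (n - 1) 0 h0I)
    refine tendsto_nhds_unique_of_eventuallyEq
      (hlim n (fun k => T (φ k)) T' (fun k => hTI (φ k)) hTφ) hc ((hev n).mono fun k hk => ?_)
    exact hmatch (φ k) n hk
  · -- the floor at the section
    exact ge_of_tendsto' (hpt 0 0 h0I) fun k => hlo (φ k)

/-- **From the full-lattice witness on `[0, Tmax]` to the fundamental interval `[-s, -1]`.**
Time translation by `s = 1 + T`: a one-period witness on `[0, Tmax]` with flight time `T` and matching
`Z_n(T) = ((1+T)/Λ) Z_{n-1}(0)` gives, after `u = t − s`, the data of `scalarFront_of_latticePeriod` on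
`[-s, -1]`; envelopes stated at the worst flight time `Tmax` imply the envelopes at `s`. [elementary] -/
theorem latticePeriod_translate {L : ℝ} (hL : 0 < L) (b : ℤ → ℝ) {Tmin Tmax T P B : ℝ}
    (hTmin : 0 < Tmin) (hT : T ∈ Icc Tmin Tmax) {Z : ℤ → ℝ → ℝ}
    (hD : ∀ n : ℤ, ∀ t ∈ Icc (0 : ℝ) Tmax, HasDerivWithinAt (Z n)
        (L ^ (n - 1) * Z (n - 1) t ^ 2 - L ^ n * Z n t * Z (n + 1) t) (Icc (0 : ℝ) Tmax) t)
    (hbox : ∀ n : ℤ, ∀ t ∈ Icc (0 : ℝ) Tmax, |Z n t| ≤ b n)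
    (hmatch : ∀ n : ℤ, Z n T = (1 + T) / L * Z (n - 1) 0)
    (hbw : ∀ n : ℤ, n < 0 → b n ≤ P * ((1 + Tmax) / L) ^ n)
    (hbl : ∀ n : ℤ, 0 ≤ n → b n ≤ B * (((1 + Tmax) * L) ^ n)⁻¹) :
    (∀ n : ℤ, ∀ u ∈ Icc (-(1 + T)) (-1), HasDerivWithinAt (fun u => Z n (u + (1 + T)))
        (L ^ (n - 1) * Z (n - 1) (u + (1 + T)) ^ 2 - L ^ n * Z n (u + (1 + T)) * Z (n + 1) (u + (1 + T)))
        (Icc (-(1 + T)) (-1)) u) ∧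
    (∀ n : ℤ, Z n (-1 + (1 + T)) = (1 + T) / L * Z (n - 1) (-(1 + T) + (1 + T))) ∧
    (∃ P' : ℝ, ∀ n : ℤ, n < 0 → ∀ u ∈ Icc (-(1 + T)) (-1),
        |Z n (u + (1 + T))| ≤ P' * ((1 + T) / L) ^ n) ∧
    (∃ B' : ℝ, ∀ n : ℤ, 0 ≤ n → ∀ u ∈ Icc (-(1 + T)) (-1),
        |Z n (u + (1 + T))| ≤ B' * (((1 + T) * L) ^ n)⁻¹) := by
  have hs1 : 1 < 1 + T := by linarith [hT.1]
  have hs0 : 0 < 1 + T := by linarith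
  have hmem : ∀ u ∈ Icc (-(1 + T)) (-1), u + (1 + T) ∈ Icc (0 : ℝ) Tmax := by
    intro u hu; exact ⟨by linarith [hu.1], by linarith [hu.2, hT.2]⟩
  have hb0 : ∀ n, 0 ≤ b n := fun n =>
    (abs_nonneg _).trans (hbox n 0 ⟨le_rfl, hTmin.le.trans (hT.1.trans hT.2)⟩)
  have hP0 : 0 ≤ P := by
    have h := (hb0 (-1)).trans (hbw (-1) (by norm_num))
    exact nonneg_of_mul_nonneg_left h (zpow_pos (div_pos (by linarith [hT.1, hT.2]) hL) _)
  have hB0 : 0 ≤ B := by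
    have h := (hb0 0).trans (hbl 0 le_rfl)
    rwa [zpow_zero, inv_one, mul_one] at h
  refine ⟨fun n u hu => ?_, fun n => ?_, ⟨P, fun n hn u hu => ?_⟩, ⟨B, fun n hn u hu => ?_⟩⟩
  · have h2 : HasDerivAt (fun u : ℝ => u + (1 + T)) 1 u := (hasDerivAt_id u).add_const _
    have := (hD n (u + (1 + T)) (hmem u hu)).comp u h2.hasDerivWithinAt (fun u' hu' => hmem u' hu')
    simpa only [mul_one, Function.comp_def] using this
  · rw [show -1 + (1 + T) = T by ring, show -(1 + T) + (1 + T) = 0 by ring]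
    exact hmatch n
  · -- wake envelope: `x ↦ x^n` is antitone for `n < 0`
    refine (hbox n _ (hmem u hu)).trans ((hbw n hn).trans (mul_le_mul_of_nonneg_left ?_ hP0))
    have hx : 0 < (1 + T) / L := div_pos hs0 hL
    have hxy : (1 + T) / L ≤ (1 + Tmax) / L := div_le_div_of_nonneg_right (by linarith [hT.2]) hL.le
    have e1 : ((1 + Tmax) / L) ^ n = (((1 + Tmax) / L) ^ (-n))⁻¹ := by rw [zpow_neg, inv_inv]
    have e2 : ((1 + T) / L) ^ n = (((1 + T) / L) ^ (-n))⁻¹ := by rw [zpow_neg, inv_inv]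
    rw [e1, e2]
    exact inv_anti₀ (zpow_pos hx _) (zpow_le_zpow_left₀ (show (0 : ℤ) ≤ -n by omega) hx.le hxy)
  · -- leading-edge envelope: `x ↦ (x^n)⁻¹` is antitone for `n ≥ 0`
    refine (hbox n _ (hmem u hu)).trans ((hbl n hn).trans (mul_le_mul_of_nonneg_left ?_ hB0))
    have hx : 0 < (1 + T) * L := mul_pos hs0 hL
    have hxy : (1 + T) * L ≤ (1 + Tmax) * L := mul_le_mul_of_nonneg_right (by linarith [hT.2]) hL.le
    exact inv_anti₀ (zpow_pos hx _) (zpow_le_zpow_left₀ hn hx.le hxy)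

/-- **`DyadicScalarFronts` reduced to relative periodic points of the TRUNCATED (finite-dimensional)
dyadic lattices.**  If at arbitrarily small scale ratios `Λ = (1+ε₀)^{5/2}` there are a flight-time window
`[Tmin, Tmax]` (`Tmin > 0`), a floor `lo > 0` and a box `b` dominated by the wake envelope
`P ((1+Tmax)/Λ)ⁿ` (`n < 0`) and the leading-edge envelope `B ((1+Tmax)Λ)^{-n}` (`n ≥ 0`), such that at
arbitrarily high truncation level the truncated dyadic lattice has a relative periodic point in the box
(interior matching `Z_n(T) = ((1+T)/Λ) Z_{n-1}(0)`, section `lo ≤ Z_0(0)`), then `DyadicScalarFronts`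
holds: truncation limit (`latticePeriod_of_truncations`) → time translation (`latticePeriod_translate`)
→ unrolling with admissibility (`dyadicScalarFronts_of_latticePeriods`).  What is left for closing
stmt-21808 as refuted is therefore a FINITE-DIMENSIONAL fixed-point problem with uniform bounds
(Brouwer/Schauder on a box of truncated lattice states, as in `PerpetualPumpCircuitPump`).
[cite: Tao2016AveragedNS, §1.2, §4 (4.8); cell vocabulary (`DyadicScalarFronts`)] -/
theorem dyadicScalarFronts_of_truncatedPeriods
    (h : ∀ ε : ℝ, 0 < ε → ∃ ε₀ : ℝ, 0 < ε₀ ∧ ε₀ ≤ ε ∧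
      ∃ (Tmin Tmax lo P B : ℝ) (b : ℤ → ℝ), 0 < Tmin ∧ Tmin ≤ Tmax ∧ 0 < lo ∧
      (∀ n : ℤ, n < 0 → b n ≤ P * ((1 + Tmax) / bigLam ε₀) ^ n) ∧
      (∀ n : ℤ, 0 ≤ n → b n ≤ B * (((1 + Tmax) * bigLam ε₀) ^ n)⁻¹) ∧
      ∀ K₀ : ℕ, ∃ K : ℕ, K₀ ≤ K ∧ ∃ (T : ℝ) (Z : ℤ → ℝ → ℝ), T ∈ Icc Tmin Tmax ∧
        (∀ n : ℤ, |n| ≤ (K : ℤ) → ∀ t ∈ Icc (0 : ℝ) Tmax, HasDerivWithinAt (Z n)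
          (bigLam ε₀ ^ (n - 1) * Z (n - 1) t ^ 2 - bigLam ε₀ ^ n * Z n t * Z (n + 1) t)
          (Icc (0 : ℝ) Tmax) t) ∧
        (∀ n : ℤ, (K : ℤ) < |n| → ∀ t ∈ Icc (0 : ℝ) Tmax, Z n t = 0) ∧
        (∀ n : ℤ, ∀ t ∈ Icc (0 : ℝ) Tmax, |Z n t| ≤ b n) ∧
        (∀ n : ℤ, |n| < (K : ℤ) → Z n T = (1 + T) / bigLam ε₀ * Z (n - 1) 0) ∧
        lo ≤ Z 0 0) :
    DyadicScalarFronts := by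
  refine dyadicScalarFronts_of_latticePeriods fun ε hε => ?_
  obtain ⟨ε₀, hε₀, hle, Tmin, Tmax, lo, P, B, b, hTmin, hTT, hlo, hbw, hbl, H⟩ := h ε hε
  have hΛ : 0 < bigLam ε₀ := bigLam_pos (by linarith)
  obtain ⟨T, Z, hT, hD, hbox, hmatch, hZ0⟩ := latticePeriod_of_truncations b hTmin hTT H
  obtain ⟨hD', hper', hw', hl'⟩ := latticePeriod_translate hΛ b hTmin hT hD hbox hmatch hbw hbl
  refine ⟨ε₀, hε₀, hle, 1 + T, by linarith [hT.1], fun n u => Z n (u + (1 + T)), hD', hper', hw', hl',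
    0, -(1 + T), ⟨le_rfl, by linarith [hT.1]⟩, ?_⟩
  show Z 0 (-(1 + T) + (1 + T)) ≠ 0
  rw [show -(1 + T) + (1 + T) = 0 by ring]
  exact ne_of_gt (lt_of_lt_of_le hlo hZ0)

/-- **Kill criterion for `TailRatchet`, finite-dimensional form.**  Relative periodic points of the
truncated dyadic lattices in envelope-dominated boxes at arbitrarily small scale ratios (as in
`dyadicScalarFronts_of_truncatedPeriods`) refute `WakeRatchet.TailRatchet`
(stmt-NavierStokesRegularity-21808). [cite: Tao2016AveragedNS, §1.2, §4; cell vocabulary] -/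
theorem not_tailRatchet_of_truncatedPeriods
    (h : ∀ ε : ℝ, 0 < ε → ∃ ε₀ : ℝ, 0 < ε₀ ∧ ε₀ ≤ ε ∧
      ∃ (Tmin Tmax lo P B : ℝ) (b : ℤ → ℝ), 0 < Tmin ∧ Tmin ≤ Tmax ∧ 0 < lo ∧
      (∀ n : ℤ, n < 0 → b n ≤ P * ((1 + Tmax) / bigLam ε₀) ^ n) ∧
      (∀ n : ℤ, 0 ≤ n → b n ≤ B * (((1 + Tmax) * bigLam ε₀) ^ n)⁻¹) ∧
      ∀ K₀ : ℕ, ∃ K : ℕ, K₀ ≤ K ∧ ∃ (T : ℝ) (Z : ℤ → ℝ → ℝ), T ∈ Icc Tmin Tmax ∧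
        (∀ n : ℤ, |n| ≤ (K : ℤ) → ∀ t ∈ Icc (0 : ℝ) Tmax, HasDerivWithinAt (Z n)
          (bigLam ε₀ ^ (n - 1) * Z (n - 1) t ^ 2 - bigLam ε₀ ^ n * Z n t * Z (n + 1) t)
          (Icc (0 : ℝ) Tmax) t) ∧
        (∀ n : ℤ, (K : ℤ) < |n| → ∀ t ∈ Icc (0 : ℝ) Tmax, Z n t = 0) ∧
        (∀ n : ℤ, ∀ t ∈ Icc (0 : ℝ) Tmax, |Z n t| ≤ b n) ∧
        (∀ n : ℤ, |n| < (K : ℤ) → Z n T = (1 + T) / bigLam ε₀ * Z (n - 1) 0) ∧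
        lo ≤ Z 0 0) :
    ¬ Summit.NavierStokesRegularity.NavierStokesRegularity.Theses.WakeRatchet.TailRatchet :=
  TailRatchet_false_of_DyadicScalarFronts (dyadicScalarFronts_of_truncatedPeriods h)

end WakeRatchetLatticePeriod

end Summit.NavierStokesRegularity.NavierStokesRegularity.Theorems

end
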